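import Mathlib
import HarnessLib
import Literature.Analysis.FluidPDE.VectorCalculus
import Literature.Analysis.FluidPDE.VorticityCalculus
import Summits.NavierStokesRegularity.NavierStokesRegularity.Theorems.UnthreadedRigidityDoorUnthreadedRigidityProfileHornRadial
import Summits.NavierStokesRegularity.NavierStokesRegularity.Theorems.UnthreadedRigidityDoorUnthreadedRigidityVirialHornAngularJets
import Summits.NavierStokesRegularity.NavierStokesRegularity.Theorems.UnthreadedRigidityDoorUnthreadedRigidityVirialHornShellFields

/-!
# Route `UnthreadedRigidityDoor`, item `UnthreadedRigidity` (W2, stmt-NavierStokesRegularity-27585) — LINE g11-1 «VIRIAL HORN»: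
# the separable shell decays like `|x|⁻³` and lies in `L⁴` (the explicit-field hypothesis of the window bridge V-W)

Prover file (engine-1 g71, free prover hand; `--supports stmt-NavierStokesRegularity-27585 --as helper`) for LINE g11-1 «VIRIAL HORN»
of planner ns-idea-6 g11 (objects BY NAME in `…VirialHornDefs.lean`, p695782).  THE SHELL-L⁴ FACT — exactly the hypothesis of
`ThreadingJets.virialWindowSilence_of_sliceLaw` (ns-crc-p1 g8, `…ThreadingJetsWindowSilence.lean`):
`memLp_four_sepShellL : ∀ l H Y x₀, 1 ≤ l → VirialAdmissible l H → IsSolidHarmonic l Y → MemLp (sepShellL H Y x₀) 4 volume`.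
Proof: THEOREM SEP in the kernel (`sepShellL_apply_add`, ns-crc-p2 g8's `…VirialHornShellFields`: `u₀(x₀+y) = (2|y|²h′ + (l+1)h)∇Y − (2lh′Y)y`,
i.e. `α∇Y − (lH′/r)Y y`); the growth bounds `|Y(y)| ≤ M|y|^l`, `|∇Y(y)| ≤ M|y|^{l−1}` off the unit ball (homogeneity + compactness of the sphere,
`IsSolidHarmonic.exists_growth_bound`); the admissible decay `r^{l+2}|H|, r^{l+3}|H′| ≤ C` ⇒ `|u₀(x₀+y)|·|y|³ ≤ (2l+2)MC` (`exists_decay_sepShellL`);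
continuity on the unit ball ⇒ `|u₀(x)| ≤ K(1+|x−x₀|)⁻³` (`exists_bound_sepShellL`); `(1+|x|)^{-12} ∈ L¹(ℝ³)` (`integrable_one_add_norm`) ⇒ `u₀ ∈ L⁴`.

HONEST LABEL: explicit-data calculus for one RUNG line; `UnthreadedRigidity` (27585), W2 and NS regularity remain OPEN; nothing here is a statement
about Navier–Stokes solutions.  0 kit.
-/

-- the summit and its single sub-problem share the name (CONVENTIONS §1), as in every Theorems file
set_option linter.dupNamespace false

namespace Summit.NavierStokesRegularity.NavierStokesRegularity.Theorems.UnthreadedRigidity.VirialHorn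

open scoped InnerProductSpace Topology ContDiff ENNReal
open Filter Set MeasureTheory
open Literature.Analysis.FluidPDE
open Summit.NavierStokesRegularity.NavierStokesRegularity.Theorems.UnthreadedRigidity.ProfileHorn (E3 deriv_profile)

/-! ## The shell as a smooth field -/

section Smooth

variable {l : ℕ} {H h : ℝ → ℝ} {Y : E3 → ℝ}

/-- the separable shell is a smooth field (two curls of the smooth centred shell, translated). -/
theorem contDiff_top_sepShellL (hh : ContDiff ℝ (⊤ : ℕ∞) h) (hH : ∀ r, 0 ≤ r → H r = h (r ^ 2)) (hY : IsSolidHarmonic l Y) (x₀ : E3) :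
    ContDiff ℝ (⊤ : ℕ∞) (sepShellL H Y x₀) := by
  rw [sepShellL_eq_comp_sub hH]
  have h1 : ContDiff ℝ (⊤ : ℕ∞) (fun z : E3 => (h (‖z‖ ^ 2) * Y z) • z) := contDiff_shell hh hY
  have h2 : ContDiff ℝ (⊤ : ℕ∞) (curl fun z : E3 => (h (‖z‖ ^ 2) * Y z) • z) := contDiff_curl (n := ⊤) (by simpa using h1)
  have h3 : ContDiff ℝ (⊤ : ℕ∞) (curl (curl fun z : E3 => (h (‖z‖ ^ 2) * Y z) • z)) := contDiff_curl (n := ⊤) (by simpa using h2)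
  exact h3.comp (contDiff_id.sub contDiff_const)

/-- the separable shell is continuous. -/
theorem continuous_sepShellL' (hh : ContDiff ℝ (⊤ : ℕ∞) h) (hH : ∀ r, 0 ≤ r → H r = h (r ^ 2)) (hY : IsSolidHarmonic l Y) (x₀ : E3) :
    Continuous (sepShellL H Y x₀) :=
  (contDiff_top_sepShellL hh hH hY x₀).continuous

end Smooth

/-! ## Homogeneity bounds for a solid harmonic away from the origin -/

section Bounds

variable {l : ℕ} {Y : E3 → ℝ}

/-- degree-`l` growth of a solid harmonic and its gradient off the unit ball: `|Y(y)| ≤ M|y|^l`, `|∇Y(y)| ≤ M|y|^{l−1}` for `|y| ≥ 1`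
(here `l = k + 1`). -/
theorem IsSolidHarmonic.exists_growth_bound {k : ℕ} (hY : IsSolidHarmonic (k + 1) Y) :
    ∃ M : ℝ, 0 ≤ M ∧ ∀ y : E3, 1 ≤ ‖y‖ → |Y y| ≤ M * ‖y‖ ^ (k + 1) ∧ ‖gradient Y y‖ ≤ M * ‖y‖ ^ k := by
  obtain ⟨M₁, hM₁⟩ := (isCompact_sphere (0 : E3) 1).exists_bound_of_continuousOn hY.contDiff.continuous.continuousOn
  obtain ⟨M₂, hM₂⟩ := (isCompact_sphere (0 : E3) 1).exists_bound_of_continuousOn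
    hY.contDiff_gradient.continuous.continuousOn
  refine ⟨max 0 (max M₁ M₂), le_max_left _ _, fun y hy => ?_⟩
  have hr : 0 < ‖y‖ := lt_of_lt_of_le one_pos hy
  set z : E3 := ‖y‖⁻¹ • y with hz
  have hzs : z ∈ Metric.sphere (0 : E3) 1 := by
    rw [mem_sphere_zero_iff_norm, hz, norm_smul, norm_inv, norm_norm, inv_mul_cancel₀ hr.ne']
  have hyz : y = ‖y‖ • z := by rw [hz, smul_smul, mul_inv_cancel₀ hr.ne', one_smul]
  have hM₁' : ‖Y z‖ ≤ max 0 (max M₁ M₂) := (hM₁ z hzs).trans ((le_max_left _ _).trans (le_max_right _ _))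
  have hM₂' : ‖gradient Y z‖ ≤ max 0 (max M₁ M₂) := (hM₂ z hzs).trans ((le_max_right _ _).trans (le_max_right _ _))
  constructor
  · have h1 : Y y = ‖y‖ ^ (k + 1) * Y z := by
      conv_lhs => rw [hyz]
      exact hY.apply_smul ‖y‖ z
    rw [h1, abs_mul, abs_pow, abs_norm, mul_comm]
    exact mul_le_mul_of_nonneg_right (by simpa [Real.norm_eq_abs] using hM₁') (by positivity)
  · have h2 : gradient Y y = ‖y‖ ^ k • gradient Y z := by
      conv_lhs => rw [hyz]
      rw [hY.gradient_smul ‖y‖ hr z]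
      congr 1
      rw [show ((k + 1 : ℕ) : ℤ) - 1 = (k : ℤ) by push_cast; ring, zpow_natCast]
    rw [h2, norm_smul, norm_pow, norm_norm, mul_comm]
    exact mul_le_mul_of_nonneg_right hM₂' (by positivity)

end Bounds

/-! ## Decay of the separable shell and membership in `L⁴` -/

section Decay

variable {l : ℕ} {H : ℝ → ℝ} {Y : E3 → ℝ}

/-- **DECAY OF THE SHELL**: for a virial-admissible profile and a solid harmonic of degree `l ≥ 1`, `|u₀(x₀ + y)| |y|³ ≤ K` for `|y| ≥ 1`
(`u₀ = α∇Y − (lH′/r)Y y` with `r^{l+2}|H|, r^{l+3}|H′| ≤ C` and `|∇Y| ≤ M r^{l−1}`, `|Y| ≤ M r^l`). -/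
theorem exists_decay_sepShellL (hl : 1 ≤ l) (hH : VirialAdmissible l H) (hY : IsSolidHarmonic l Y) (x₀ : E3) :
    ∃ K : ℝ, 0 ≤ K ∧ ∀ y : E3, 1 ≤ ‖y‖ → ‖sepShellL H Y x₀ (x₀ + y)‖ * ‖y‖ ^ 3 ≤ K := by
  obtain ⟨k, rfl⟩ : ∃ k, l = k + 1 := ⟨l - 1, by omega⟩
  obtain ⟨⟨h, hh, hHh⟩, ⟨C, hC⟩⟩ := hH
  obtain ⟨M, hM0, hM⟩ := hY.exists_growth_bound
  have hhd : Differentiable ℝ h := hh.differentiable (by simp)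
  have hC0 : 0 ≤ C := by
    have := (hC 1 le_rfl).1
    exact le_trans (by positivity) this
  refine ⟨(2 * (k : ℝ) + 4) * M * C, by positivity, fun y hy => ?_⟩
  have hr : 0 < ‖y‖ := lt_of_lt_of_le one_pos hy
  set r := ‖y‖ with hrdef
  obtain ⟨hYb, hGb⟩ := hM y hy
  obtain ⟨hC1, hC2, -⟩ := hC r hy
  -- the explicit shell at `x₀ + y` (THEOREM SEP, `…VirialHornShellFields`), coefficients rearranged
  have hu : sepShellL H Y x₀ (x₀ + y) =
      (2 * r ^ 2 * deriv h (r ^ 2) + (((k + 1 : ℕ) : ℝ) + 1) * h (r ^ 2)) • gradient Y y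
        - (2 * ((k + 1 : ℕ) : ℝ) * deriv h (r ^ 2) * Y y) • y := by
    rw [sepShellL_apply_add hHh (hh.of_le (by norm_cast)) hY x₀ y]
  -- the two coefficients in terms of `H`, `H′`
  have ha : 2 * r ^ 2 * deriv h (r ^ 2) + (((k + 1 : ℕ) : ℝ) + 1) * h (r ^ 2) = r * deriv H r + ((k : ℝ) + 2) * H r := by
    rw [deriv_profile hhd hHh hr, hHh r hr.le]; push_cast; ring
  have hb : 2 * ((k + 1 : ℕ) : ℝ) * deriv h (r ^ 2) * r = ((k : ℝ) + 1) * deriv H r := by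
    rw [deriv_profile hhd hHh hr]; push_cast; ring
  -- norm of the shell
  have hnorm : ‖sepShellL H Y x₀ (x₀ + y)‖ ≤
      (r * |deriv H r| + ((k : ℝ) + 2) * |H r|) * ‖gradient Y y‖ + ((k : ℝ) + 1) * |deriv H r| * |Y y| := by
    rw [hu]
    refine (norm_sub_le _ _).trans ?_
    rw [norm_smul, norm_smul, Real.norm_eq_abs, Real.norm_eq_abs, ha]
    have e2 : |2 * ((k + 1 : ℕ) : ℝ) * deriv h (r ^ 2) * Y y| * ‖y‖ = ((k : ℝ) + 1) * |deriv H r| * |Y y| := by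
      rw [← hrdef]
      have : |2 * ((k + 1 : ℕ) : ℝ) * deriv h (r ^ 2) * Y y| * r = |2 * ((k + 1 : ℕ) : ℝ) * deriv h (r ^ 2) * r| * |Y y| := by
        rw [abs_mul, abs_mul (2 * _ * _) r, abs_of_pos hr]; ring
      rw [this, hb, abs_mul, abs_of_nonneg (by positivity : (0 : ℝ) ≤ (k : ℝ) + 1)]
    rw [e2]
    gcongr
    calc |r * deriv H r + ((k : ℝ) + 2) * H r| ≤ |r * deriv H r| + |((k : ℝ) + 2) * H r| := abs_add_le _ _
      _ = r * |deriv H r| + ((k : ℝ) + 2) * |H r| := by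
        rw [abs_mul, abs_mul, abs_of_pos hr, abs_of_nonneg (by positivity : (0 : ℝ) ≤ (k : ℝ) + 2)]
  -- multiply by `r³` and use the bounds
  have hpow : r ^ k * r ^ 3 = r ^ (k + 3) := by ring
  calc ‖sepShellL H Y x₀ (x₀ + y)‖ * r ^ 3
      ≤ ((r * |deriv H r| + ((k : ℝ) + 2) * |H r|) * ‖gradient Y y‖ + ((k : ℝ) + 1) * |deriv H r| * |Y y|) * r ^ 3 :=
        mul_le_mul_of_nonneg_right hnorm (by positivity)
    _ ≤ ((r * |deriv H r| + ((k : ℝ) + 2) * |H r|) * (M * r ^ k) + ((k : ℝ) + 1) * |deriv H r| * (M * r ^ (k + 1))) * r ^ 3 := by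
        gcongr
    _ = M * (r ^ (k + 1 + 3) * |deriv H r|) + ((k : ℝ) + 2) * M * (r ^ (k + 1 + 2) * |H r|)
          + ((k : ℝ) + 1) * M * (r ^ (k + 1 + 3) * |deriv H r|) := by ring
    _ ≤ M * C + ((k : ℝ) + 2) * M * C + ((k : ℝ) + 1) * M * C := by
        gcongr
    _ = (2 * (k : ℝ) + 4) * M * C := by ring

/-- **GLOBAL BOUND**: `|u₀(x)| ≤ K (1 + |x − x₀|)⁻³` everywhere (continuity on the unit ball, decay outside). -/
theorem exists_bound_sepShellL (hl : 1 ≤ l) (hH : VirialAdmissible l H) (hY : IsSolidHarmonic l Y) (x₀ : E3) :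
    ∃ K : ℝ, 0 ≤ K ∧ ∀ x : E3, ‖sepShellL H Y x₀ x‖ ≤ K * ((1 + ‖x - x₀‖) ^ 3)⁻¹ := by
  obtain ⟨K, hK0, hK⟩ := exists_decay_sepShellL hl hH hY x₀
  obtain ⟨⟨h, hh, hHh⟩, -⟩ := hH
  have hcont : Continuous (sepShellL H Y x₀) := continuous_sepShellL' hh hHh hY x₀
  obtain ⟨B, hB⟩ := (isCompact_closedBall x₀ 1).exists_bound_of_continuousOn hcont.continuousOn
  have hB0 : 0 ≤ B := le_trans (norm_nonneg _) (hB x₀ (Metric.mem_closedBall_self zero_le_one))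
  refine ⟨8 * max B K, by positivity, fun x => ?_⟩
  set r := ‖x - x₀‖ with hr
  have hr0 : 0 ≤ r := norm_nonneg _
  have hpos : 0 < (1 + r) ^ 3 := by positivity
  rw [← div_eq_mul_inv, le_div_iff₀ hpos]
  by_cases h1 : r ≤ 1
  · -- inside the unit ball: `(1+r)³ ≤ 8`
    have hx : x ∈ Metric.closedBall x₀ 1 := by rw [Metric.mem_closedBall, dist_eq_norm]; exact h1
    have h8 : (1 + r) ^ 3 ≤ 8 := by
      have := pow_le_pow_left₀ (by positivity) (by linarith : 1 + r ≤ 2) 3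
      norm_num at this
      exact this
    calc ‖sepShellL H Y x₀ x‖ * (1 + r) ^ 3 ≤ B * 8 := by
          gcongr
          exact hB x hx
      _ ≤ 8 * max B K := by linarith [le_max_left B K]
  · -- outside: `(1+r)³ ≤ 8 r³` and the decay bound
    push Not at h1
    have hy : 1 ≤ ‖x - x₀‖ := h1.le
    have hdec := hK (x - x₀) hy
    rw [add_sub_cancel] at hdec
    have h8 : (1 + r) ^ 3 ≤ 8 * r ^ 3 := by
      have := pow_le_pow_left₀ (by positivity) (by linarith : 1 + r ≤ 2 * r) 3
      rw [mul_pow] at this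
      norm_num at this
      exact this
    calc ‖sepShellL H Y x₀ x‖ * (1 + r) ^ 3 ≤ ‖sepShellL H Y x₀ x‖ * (8 * r ^ 3) := by gcongr
      _ = 8 * (‖sepShellL H Y x₀ x‖ * r ^ 3) := by ring
      _ ≤ 8 * K := by gcongr
      _ ≤ 8 * max B K := by gcongr; exact le_max_right B K

/-- **THE SHELL-L⁴ FACT** (the explicit-field hypothesis of `ThreadingJets.virialWindowSilence_of_sliceLaw`, ns-crc-p1 g8): a virial-admissible
separable shell of degree `l ≥ 1` is in `L⁴(ℝ³)` (indeed `|u₀| ≲ (1+|x−x₀|)⁻³`). -/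
theorem memLp_four_sepShellL : ∀ (l : ℕ) (H : ℝ → ℝ) (Y : E3 → ℝ) (x₀ : E3), 1 ≤ l → VirialAdmissible l H → IsSolidHarmonic l Y →
    MemLp (sepShellL H Y x₀) 4 volume := by
  intro l H Y x₀ hl hH hY
  obtain ⟨K, hK0, hK⟩ := exists_bound_sepShellL hl hH hY x₀
  obtain ⟨⟨h, hh, hHh⟩, -⟩ := hH
  have hcont : Continuous (sepShellL H Y x₀) := continuous_sepShellL' hh hHh hY x₀
  have hmeas : AEStronglyMeasurable (sepShellL H Y x₀) volume := hcont.aestronglyMeasurable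
  rw [← integrable_norm_rpow_iff hmeas (by norm_num) (by norm_num)]
  -- the dominating function `K⁴ (1 + |x − x₀|)^{-12}`
  have hdim : (Module.finrank ℝ E3 : ℝ) < 12 := by
    rw [finrank_euclideanSpace_fin]; norm_num
  have hg : Integrable (fun x : E3 => K ^ 4 * (1 + ‖x - x₀‖) ^ (-(12 : ℝ))) volume :=
    ((integrable_one_add_norm hdim).comp_sub_right x₀).const_mul (K ^ 4)
  have hmeas4 : AEStronglyMeasurable (fun x : E3 => ‖sepShellL H Y x₀ x‖ ^ (4 : ℝ≥0∞).toReal) volume :=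
    (hcont.norm.rpow_const fun _ => Or.inr (by norm_num)).aestronglyMeasurable
  refine hg.mono' hmeas4 (Eventually.of_forall fun x => ?_)
  have hpos : 0 < 1 + ‖x - x₀‖ := by positivity
  rw [Real.norm_eq_abs, abs_of_nonneg (by positivity)]
  have htoReal : (4 : ℝ≥0∞).toReal = ((4 : ℕ) : ℝ) := by norm_num
  rw [htoReal, Real.rpow_natCast, Real.rpow_neg hpos.le, show (12 : ℝ) = ((12 : ℕ) : ℝ) by norm_num, Real.rpow_natCast]
  have hb := hK x
  have hnn : 0 ≤ ‖sepShellL H Y x₀ x‖ := norm_nonneg _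
  calc ‖sepShellL H Y x₀ x‖ ^ 4 ≤ (K * ((1 + ‖x - x₀‖) ^ 3)⁻¹) ^ 4 := by gcongr
    _ = K ^ 4 * ((1 + ‖x - x₀‖) ^ 12)⁻¹ := by rw [mul_pow, inv_pow, ← pow_mul]

end Decay

end Summit.NavierStokesRegularity.NavierStokesRegularity.Theorems.UnthreadedRigidity.VirialHorn
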